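import Summits.Ventures.Crystal3D.Bulk.GapNoHalfPlane
import Summits.Ventures.Crystal3D.Bulk.GapIntruderStar
import HarnessLib

/-!
# Tight degrees in the GAP census: a non-rattler shell ball has at least three tight partners,
# and the intruder touches at least three shell balls (P-L2 lower parts)

HONEST FRAMING. Part of the venture `Summits/Ventures/Crystal3D` (cell `pub-crystal3d`, phase 2,
24-hour sprint `PLAN.md` R42; seat typer-bulk-2). From the two "no closed tangent half-plane"
lemmas (`IsReducedExtremal.exists_inner_pos`, `Bulk/GapNoHalfPlane.lean`, at shell vertices;
`IsExtremal.exists_inner_pos_intruder`, `Bulk/GapIntruderStar.lean`, at the intruder) and one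
piece of linear algebra in `ℝ³` (`exists_tangent_nonpos_pair`: for a unit vector `u` and ANY two
vectors `q₁, q₂` there is a nonzero tangent vector `n ⊥ u` with `⟪n, q₁⟫ ≤ 0` and `⟪n, q₂⟫ ≤ 0`)
we get the degree facts of the cell's `DESIGN-L12-THEORY.md` P-L2(b),(c) (lower parts;
Musin–Tarasov 2012 Prop. 3.3 "degrees `0, 3, 4, 5`" in the two-threshold setting):

* `IsReducedExtremal.three_le_card_tight`: at a reduced extremal configuration, a shell ball with
  at least one tight partner (shell ball or intruder at distance `1`) has at least THREE;
* `IsExtremal.three_le_card_intruderContacts`: at an extremal configuration the intruder touches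
  at least THREE shell balls (TARGET-GAP §4 / R41.3: "intruder touching `≥ 3` shell balls is
  automatic").

With `Bulk/GapDegrees.lean` (`≤ 5` on both counts) the tight degrees of the census are pinned to
`{0} ∪ {3, 4, 5}` at shell balls (counting the intruder as a possible partner) and `{3, 4, 5}` at
the intruder. The sharper `deg p ≤ 4` below `58.28°` is a corner-angle fact not proved here.
Nothing numerical; nothing claimed about GAP(1.26).
-/

noncomputable section

open scoped BigOperators InnerProductSpace
open Finset

namespace Summit.Ventures.Crystal3D

/-! ## Linear algebra: a tangent direction non-positive against two given vectors -/

/-- In `ℝ³`, two vectors have a common nonzero orthogonal vector. -/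
theorem exists_ne_zero_inner_eq_zero_pair (a b : EuclideanSpace ℝ (Fin 3)) :
    ∃ n : EuclideanSpace ℝ (Fin 3), n ≠ 0 ∧ ⟪a, n⟫_ℝ = 0 ∧ ⟪b, n⟫_ℝ = 0 := by
  classical
  set K : Submodule ℝ (EuclideanSpace ℝ (Fin 3)) :=
    Submodule.span ℝ ((({a, b} : Finset (EuclideanSpace ℝ (Fin 3))) : Set _)) with hKdef
  have hK : Kᗮ ≠ ⊥ := by
    intro hbot
    have h1 := Submodule.finrank_add_finrank_orthogonal K
    rw [hbot, finrank_bot, finrank_euclideanSpace_fin] at h1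
    have h2 : Module.finrank ℝ K ≤ 2 :=
      (finrank_span_finset_le_card ({a, b} : Finset (EuclideanSpace ℝ (Fin 3)))).trans
        Finset.card_le_two
    omega
  obtain ⟨n, hn, hn0⟩ := Submodule.exists_mem_ne_zero_of_ne_bot hK
  refine ⟨n, hn0, ?_, ?_⟩
  · rw [Submodule.mem_orthogonal] at hn
    exact hn a (Submodule.subset_span (by simp))
  · rw [Submodule.mem_orthogonal] at hn
    exact hn b (Submodule.subset_span (by simp))

/-- **Two vectors always fit in a closed tangent half-plane.** For a unit vector `u` and any two
vectors `q₁, q₂` of `ℝ³` there is a nonzero `n ⊥ u` with `⟪n, q₁⟫ ≤ 0` and `⟪n, q₂⟫ ≤ 0`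
(project to the tangent plane; take `-(‖t₂‖ t₁ + ‖t₁‖ t₂)`, or a common normal when that
vanishes). -/
theorem exists_tangent_nonpos_pair (u q₁ q₂ : EuclideanSpace ℝ (Fin 3)) (hu : ‖u‖ = 1) :
    ∃ n : EuclideanSpace ℝ (Fin 3), n ≠ 0 ∧ ⟪u, n⟫_ℝ = 0 ∧ ⟪n, q₁⟫_ℝ ≤ 0 ∧ ⟪n, q₂⟫_ℝ ≤ 0 := by
  -- tangential parts
  set t₁ : EuclideanSpace ℝ (Fin 3) := q₁ - ⟪q₁, u⟫_ℝ • u with ht₁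
  set t₂ : EuclideanSpace ℝ (Fin 3) := q₂ - ⟪q₂, u⟫_ℝ • u with ht₂
  have huu : ⟪u, u⟫_ℝ = 1 := by rw [real_inner_self_eq_norm_sq, hu]; norm_num
  have ht₁u : ⟪u, t₁⟫_ℝ = 0 := by
    rw [ht₁, inner_sub_right, real_inner_smul_right, huu, real_inner_comm]; ring
  have ht₂u : ⟪u, t₂⟫_ℝ = 0 := by
    rw [ht₂, inner_sub_right, real_inner_smul_right, huu, real_inner_comm]; ring
  -- for a tangent `n`, `⟪n, qₖ⟫ = ⟪n, tₖ⟫`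
  have hkey : ∀ n : EuclideanSpace ℝ (Fin 3), ⟪u, n⟫_ℝ = 0 →
      ⟪n, q₁⟫_ℝ = ⟪n, t₁⟫_ℝ ∧ ⟪n, q₂⟫_ℝ = ⟪n, t₂⟫_ℝ := by
    intro n hn
    have hn' : ⟪n, u⟫_ℝ = 0 := by rw [real_inner_comm]; exact hn
    constructor
    · rw [ht₁, inner_sub_right, real_inner_smul_right, hn']; ring
    · rw [ht₂, inner_sub_right, real_inner_smul_right, hn']; ring
  set m : EuclideanSpace ℝ (Fin 3) := ‖t₂‖ • t₁ + ‖t₁‖ • t₂ with hm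
  by_cases hm0 : m ≠ 0
  · -- `n = -m`
    refine ⟨-m, neg_ne_zero.2 hm0, ?_, ?_, ?_⟩
    · rw [inner_neg_right, hm, inner_add_right, real_inner_smul_right, real_inner_smul_right,
        ht₁u, ht₂u]; ring
    · have hmu : ⟪u, -m⟫_ℝ = 0 := by
        rw [inner_neg_right, hm, inner_add_right, real_inner_smul_right, real_inner_smul_right,
          ht₁u, ht₂u]; ring
      rw [(hkey _ hmu).1, inner_neg_left, hm, inner_add_left, real_inner_smul_left,
        real_inner_smul_left, real_inner_self_eq_norm_sq]
      have hcs := (abs_le.1 (abs_real_inner_le_norm t₂ t₁)).1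
      have hsum : 0 ≤ ‖t₂‖ * ‖t₁‖ + ⟪t₂, t₁⟫_ℝ := by linarith
      nlinarith [mul_nonneg (norm_nonneg t₁) hsum]
    · have hmu : ⟪u, -m⟫_ℝ = 0 := by
        rw [inner_neg_right, hm, inner_add_right, real_inner_smul_right, real_inner_smul_right,
          ht₁u, ht₂u]; ring
      rw [(hkey _ hmu).2, inner_neg_left, hm, inner_add_left, real_inner_smul_left,
        real_inner_smul_left, real_inner_self_eq_norm_sq]
      have hcs := (abs_le.1 (abs_real_inner_le_norm t₁ t₂)).1
      have hsum : 0 ≤ ‖t₁‖ * ‖t₂‖ + ⟪t₁, t₂⟫_ℝ := by linarith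
      nlinarith [mul_nonneg (norm_nonneg t₂) hsum]
  · push Not at hm0
    -- `‖t₂‖ t₁ = -‖t₁‖ t₂`: the tangential parts are opposite (or one vanishes)
    by_cases h1 : t₁ = 0
    · -- any common normal of `u` and `t₂`
      obtain ⟨n, hn, hnu, hnt⟩ := exists_ne_zero_inner_eq_zero_pair u t₂
      refine ⟨n, hn, hnu, ?_, ?_⟩
      · rw [(hkey n hnu).1, h1, inner_zero_right]
      · rw [(hkey n hnu).2, real_inner_comm, hnt]
    · obtain ⟨n, hn, hnu, hnt⟩ := exists_ne_zero_inner_eq_zero_pair u t₁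
      refine ⟨n, hn, hnu, ?_, ?_⟩
      · rw [(hkey n hnu).1, real_inner_comm, hnt]
      · -- `t₂ = -(‖t₂‖/‖t₁‖) t₁`
        have hn1 : ‖t₁‖ ≠ 0 := norm_ne_zero_iff.2 h1
        have ht₂ : t₂ = -(‖t₂‖ / ‖t₁‖) • t₁ := by
          have : ‖t₁‖ • t₂ = -(‖t₂‖ • t₁) := eq_neg_of_add_eq_zero_right hm0
          calc t₂ = ‖t₁‖⁻¹ • (‖t₁‖ • t₂) := by rw [smul_smul, inv_mul_cancel₀ hn1, one_smul]
            _ = -(‖t₂‖ / ‖t₁‖) • t₁ := by rw [this, smul_neg, smul_smul, neg_smul]; ring_nf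
        rw [(hkey n hnu).2, ht₂, real_inner_smul_right, real_inner_comm, hnt, mul_zero]

/-! ## At least three tight partners -/

/-- **A non-rattler shell ball of a reduced extremal configuration has at least three tight
partners** (shell balls or the intruder at distance `1`): with at most two, a tangent direction
non-positive against both exists (`exists_tangent_nonpos_pair`), contradicting
`IsReducedExtremal.exists_inner_pos`. (P-L2(b), degrees `∉ {1, 2}`.) -/
theorem IsReducedExtremal.three_le_card_tight {c : Fin 14 → EuclideanSpace ℝ (Fin 3)}
    (hc : IsReducedExtremal c) {i : Fin 14} (hi0 : i ≠ 0) (hi13 : i ≠ 13)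
    (htight : ∃ j : Fin 14, j ≠ 0 ∧ j ≠ i ∧ dist (c i) (c j) = 1) :
    3 ≤ (univ.filter fun j : Fin 14 => j ≠ 0 ∧ j ≠ i ∧ dist (c i) (c j) = 1).card := by
  classical
  by_contra hlt
  push Not at hlt
  set T := univ.filter fun j : Fin 14 => j ≠ 0 ∧ j ≠ i ∧ dist (c i) (c j) = 1 with hT
  -- `T ⊆ {j₁, j₂}` for some labels
  obtain ⟨j₁, j₂, hsub⟩ : ∃ j₁ j₂ : Fin 14, T ⊆ {j₁, j₂} := by
    have hcard : T.card ≤ 2 := by omega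
    rcases Nat.lt_or_ge T.card 2 with h | h
    · rcases Nat.lt_or_ge T.card 1 with h' | h'
      · obtain ⟨j, hj0, hji, hd⟩ := htight
        have : j ∈ T := mem_filter.2 ⟨mem_univ _, hj0, hji, hd⟩
        have : 0 < T.card := card_pos.2 ⟨j, this⟩
        omega
      · obtain ⟨a, ha⟩ := card_eq_one.1 (by omega : T.card = 1)
        exact ⟨a, a, by rw [ha]; intro x hx; simp at hx; simp [hx]⟩
    · obtain ⟨a, b, -, hab⟩ := card_eq_two.1 (by omega : T.card = 2)
      exact ⟨a, b, hab.le⟩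
  have hu : ‖c i - c 0‖ = 1 := by rw [← dist_eq_norm]; exact hc.1.1.2 i hi0 hi13
  obtain ⟨n, hn, hnu, h1, h2⟩ := exists_tangent_nonpos_pair (c i - c 0) (c j₁ - c 0) (c j₂ - c 0) hu
  obtain ⟨j, hj0, hji, hd, hpos⟩ := hc.exists_inner_pos hi0 hi13 htight hn hnu
  have hjT : j ∈ T := mem_filter.2 ⟨mem_univ _, hj0, hji, hd⟩
  rcases mem_insert.1 (hsub hjT) with rfl | hj
  · exact absurd h1 (not_le.2 hpos)
  · rw [mem_singleton] at hj
    subst hj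
    exact absurd h2 (not_le.2 hpos)

/-- **The intruder of an extremal configuration touches at least three shell balls** (P-L2(c),
lower part; TARGET-GAP §4: "intruder touching `≥ 3` shell balls is automatic"). -/
theorem IsExtremal.three_le_card_intruderContacts {c : Fin 14 → EuclideanSpace ℝ (Fin 3)}
    (hc : IsExtremal c) :
    3 ≤ (univ.filter fun j : Fin 14 => j ≠ 0 ∧ j ≠ 13 ∧ dist (c 13) (c j) = 1).card := by
  classical
  by_contra hlt
  push Not at hlt
  set T := univ.filter fun j : Fin 14 => j ≠ 0 ∧ j ≠ 13 ∧ dist (c 13) (c j) = 1 with hT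
  obtain ⟨j₁, j₂, hsub⟩ : ∃ j₁ j₂ : Fin 14, T ⊆ {j₁, j₂} := by
    rcases Nat.lt_or_ge T.card 2 with h | h
    · rcases Nat.lt_or_ge T.card 1 with h' | h'
      · obtain ⟨j, hj0, hj13, hd⟩ := hc.exists_intruderContact
        have : j ∈ T := mem_filter.2 ⟨mem_univ _, hj0, hj13, hd⟩
        have : 0 < T.card := card_pos.2 ⟨j, this⟩
        omega
      · obtain ⟨a, ha⟩ := card_eq_one.1 (by omega : T.card = 1)
        exact ⟨a, a, by rw [ha]; intro x hx; simp at hx; simp [hx]⟩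
    · obtain ⟨a, b, -, hab⟩ := card_eq_two.1 (by omega : T.card = 2)
      exact ⟨a, b, hab.le⟩
  -- the unit hole direction
  have hD : 0 < intruderDist c := lt_trans zero_lt_one hc.1.one_lt_intruderDist
  set u : EuclideanSpace ℝ (Fin 3) := (intruderDist c)⁻¹ • (c 13 - c 0) with hudef
  have hu : ‖u‖ = 1 := by
    rw [hudef, norm_smul, Real.norm_of_nonneg (inv_nonneg.2 hD.le), ← dist_eq_norm, dist_comm]
    exact inv_mul_cancel₀ hD.ne'
  obtain ⟨n, hn, hnu, h1, h2⟩ := exists_tangent_nonpos_pair u (c j₁ - c 0) (c j₂ - c 0) hu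
  have hnt : ⟪c 13 - c 0, n⟫_ℝ = 0 := by
    have : ⟪u, n⟫_ℝ = (intruderDist c)⁻¹ * ⟪c 13 - c 0, n⟫_ℝ := by
      rw [hudef, real_inner_smul_left]
    rw [this] at hnu
    rcases mul_eq_zero.1 hnu with h | h
    · exact absurd h (inv_ne_zero hD.ne')
    · exact h
  obtain ⟨j, hj0, hj13, hd, hpos⟩ := hc.exists_inner_pos_intruder hn hnt
  have hjT : j ∈ T := mem_filter.2 ⟨mem_univ _, hj0, hj13, hd⟩
  rcases mem_insert.1 (hsub hjT) with rfl | hj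
  · exact absurd h1 (not_le.2 hpos)
  · rw [mem_singleton] at hj
    subst hj
    exact absurd h2 (not_le.2 hpos)

end Summit.Ventures.Crystal3D

end
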